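import Summits.AtomisticToContinuum.BoseEinsteinCondensation.Theorems.BECInsertionCorrectorStaticResponseToHMinusOneEulerLagrange
import Summits.AtomisticToContinuum.BoseEinsteinCondensation.Theorems.BECInsertionCorrectorCorrectorClosureResponseDictionarySymm
import Summits.AtomisticToContinuum.BoseEinsteinCondensation.Theorems.BECInsertionCorrectorCorrectorClosureTailModesAux
import Summits.AtomisticToContinuum.BoseEinsteinCondensation.Theorems.BECInsertionCorrectorCorrectorClosureMixedLawResidue
import Literature.MathematicalPhysics.QuantumManyBody.PeriodicBoseGasRelabelling
import HarnessLib

/-!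
# The tilt family of weak corrector identities, I: calculus on `(ℝ³)^{N+1} = ℝ³ × (ℝ³)^N` and the
# weak Euler–Lagrange equation of a real ground state for ALL periodic test functions
# (line `geometric-mean-corrector`, helpers for stub S4 `stub_tiltCorrector`, crux
# `BECInsertionCorrector.CorrectorClosure`, item stmt-AtomisticToContinuum-12058)

Supports (does not close) stmt-AtomisticToContinuum-12058. Content:

* calculus of the coordinate derivatives `pderiv`/`gradDot` of `WeightedCorrector.lean`: finite sums,
  simultaneous relabelling of both arguments, real powers of non-vanishing functions
  (`tilt_pderiv_rpow_const`);
* tails and slices: the chain rules `∂_{0,k}(F∘tail) = 0`, `∂_{j+1,k}(F∘tail) = (∂_{j,k}F)∘tail`,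
  `∂_{j,k}(G(x,·)) = (∂_{j+1,k}G)(x,·)` (`tail = snd ∘ (Fin.consEquivL)⁻¹` and
  `Y ↦ (0, Y) = Fin.consEquivL ∘ inr` as continuous linear maps) and
  `Γ(F∘tail, G)(x, Y) = Γ(F, G(x,·))(Y)` (`tilt_gradDot_tail_vecCons`);
* `tilt_el_all`: the weak Euler–Lagrange equation
  `∫∇|Θ|·∇(ζ|Θ|) + ∫ V ζ|Θ|² = E₀ ∫ ζ|Θ|²` of a real nonnegative finite-energy periodic ground state
  `Θ` (`StaticResponseToHMinusOne.eulerLagrange`, stated there for Bose-symmetric `ζ`) for EVERY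
  lattice-periodic `C¹` test function `ζ`, by Bose symmetrisation of `ζ` (the E–L functional is
  linear and relabelling invariant).

References: [ReedSimonIV1978] §XIII.1 (Rayleigh–Ritz); [Davies1989] §4.2 Thm 4.2.1.
-/

noncomputable section

namespace Summit.AtomisticToContinuum.BoseEinsteinCondensation.Theorems.CorrectorClosure.GeometricMeanCorrector

open MeasureTheory Filter
open scoped ENNReal NNReal ComplexConjugate BigOperators
open Literature.MathematicalPhysics.QuantumManyBody.BoseGas
open Summit.AtomisticToContinuum.BoseEinsteinCondensation.Theorems.StaticResponseToHMinusOne (eulerLagrange)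
open Summit.AtomisticToContinuum.BoseEinsteinCondensation.Cruxes.StaticResponseBound.UvThomsonForceWave
  (contDiff_norm_of_real exists_bound_on_cellN measurable_periodicInteraction_of
    integrableOn_toReal_interaction_mul_norm_sq)
open Summit.AtomisticToContinuum.BoseEinsteinCondensation.Theorems.CorrectorClosure.HealingScaleKacInsertion.ResponseDictionary
  (setIntegral_cellN_comp_perm pderiv_comp_perm contDiff_comp_perm_real)
open Summit.AtomisticToContinuum.BoseEinsteinCondensation.Theorems.CorrectorClosure.HealingScaleKacInsertion
  (hasFDerivAt_vecCons_right)

/-! ### Calculus of `pderiv`: sums, relabelling, real powers -/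

section Calculus

variable {M : ℕ}

/-- `∂_{i,k}` of a finite sum of differentiable functions is the sum of the `∂_{i,k}`. [folklore] -/
theorem tilt_pderiv_finset_sum {ι : Type*} (s : Finset ι) {f : ι → Config M → ℝ} {X : Config M}
    (hf : ∀ j ∈ s, DifferentiableAt ℝ (f j) X) (i : Fin M) (k : Fin 3) :
    pderiv i k (fun Y => ∑ j ∈ s, f j Y) X = ∑ j ∈ s, pderiv i k (f j) X := by
  unfold pderiv
  rw [(HasFDerivAt.fun_sum fun j hj => (hf j hj).hasFDerivAt).fderiv]
  simp only [FunLike.coe_sum, Finset.sum_apply]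

/-- `Γ(F, ∑ⱼ gⱼ) = ∑ⱼ Γ(F, gⱼ)` at points of differentiability. [folklore] -/
theorem tilt_gradDot_finset_sum_right {ι : Type*} (s : Finset ι) (F : Config M → ℝ)
    {g : ι → Config M → ℝ} {X : Config M} (hg : ∀ j ∈ s, DifferentiableAt ℝ (g j) X) :
    gradDot F (fun Y => ∑ j ∈ s, g j Y) X = ∑ j ∈ s, gradDot F (g j) X := by
  have h : ∀ (i : Fin M) (k : Fin 3),
      pderiv i k (fun Y => ∑ j ∈ s, g j Y) X = ∑ j ∈ s, pderiv i k (g j) X :=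
    fun i k => tilt_pderiv_finset_sum s hg i k
  simp only [gradDot, h, Finset.mul_sum]
  calc ∑ i : Fin M, ∑ k : Fin 3, ∑ j ∈ s, pderiv i k F X * pderiv i k (g j) X
      = ∑ i : Fin M, ∑ j ∈ s, ∑ k : Fin 3, pderiv i k F X * pderiv i k (g j) X :=
        Finset.sum_congr rfl fun i _ => Finset.sum_comm
    _ = ∑ j ∈ s, ∑ i : Fin M, ∑ k : Fin 3, pderiv i k F X * pderiv i k (g j) X := Finset.sum_comm

/-- `Γ(α(·∘σ), β(·∘σ))(X) = Γ(α, β)(X ∘ σ)`. [folklore] -/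
theorem tilt_gradDot_comp_perm₂ {α β : Config M → ℝ} (hα : Differentiable ℝ α)
    (hβ : Differentiable ℝ β) (σ : Equiv.Perm (Fin M)) (X : Config M) :
    gradDot (fun Y => α (Y ∘ σ)) (fun Y => β (Y ∘ σ)) X = gradDot α β (X ∘ σ) := by
  -- adapted from `gradDot_comp_perm` (ResponseDictionarySymm)
  simp only [gradDot, pderiv_comp_perm hα σ, pderiv_comp_perm hβ σ]
  exact Equiv.sum_comp σ.symm (fun i => ∑ k, pderiv i k α (X ∘ σ) * pderiv i k β (X ∘ σ))

/-- `∂_{i,k}(f^p) = p f^{p-1} ∂_{i,k} f` where `f ≠ 0` is differentiable (real power). [folklore] -/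
theorem tilt_pderiv_rpow_const {f : Config M → ℝ} {X : Config M} (hf : DifferentiableAt ℝ f X)
    (h0 : f X ≠ 0) (p : ℝ) (i : Fin M) (k : Fin 3) :
    pderiv i k (fun Y => f Y ^ p) X = p * f X ^ (p - 1) * pderiv i k f X := by
  unfold pderiv
  rw [(hf.hasFDerivAt.rpow_const (Or.inl h0)).fderiv, smul_apply, smul_eq_mul,
    mul_assoc]

/-- For `f > 0`: `∂_{i,k}(f^p) = p (f^p / f) ∂_{i,k} f`. [folklore] -/
theorem tilt_pderiv_rpow_const_of_pos {f : Config M → ℝ} {X : Config M} (hf : DifferentiableAt ℝ f X)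
    (h0 : 0 < f X) (p : ℝ) (i : Fin M) (k : Fin 3) :
    pderiv i k (fun Y => f Y ^ p) X = p * (f X ^ p / f X) * pderiv i k f X := by
  rw [tilt_pderiv_rpow_const hf h0.ne', Real.rpow_sub_one h0.ne']

end Calculus

/-! ### Slices and tails: calculus on `(ℝ³)^{N+1} = ℝ³ × (ℝ³)^N` -/

section Slices

variable {N : ℕ}

/-- `tail (e_0 ⊗ v) = 0`. [folklore] -/
theorem tilt_tail_single_zero (v : Space) :
    Fin.tail (Pi.single (0 : Fin (N + 1)) v : Config (N + 1)) = 0 := by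
  show Fin.tail (Function.update (0 : Config (N + 1)) 0 v) = 0
  rw [Fin.tail_update_zero]
  rfl

/-- `tail (e_{j+1} ⊗ v) = e_j ⊗ v`. [folklore] -/
theorem tilt_tail_single_succ (j : Fin N) (v : Space) :
    Fin.tail (Pi.single j.succ v : Config (N + 1)) = (Pi.single j v : Config N) := by
  show Fin.tail (Function.update (0 : Config (N + 1)) j.succ v) = Function.update (0 : Config N) j v
  rw [Fin.tail_update_succ]
  rfl

/-- Chain rule through `tail` (the map `Z ↦ tail Z` is the continuous linear map
`snd ∘ (Fin.consEquivL)⁻¹ : (ℝ³)^{N+1} → (ℝ³)^N`). [folklore] -/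
theorem tilt_hasFDerivAt_comp_tail {F : Config N → ℝ} {Z : Config (N + 1)}
    (hF : DifferentiableAt ℝ F (Fin.tail Z)) :
    HasFDerivAt (fun W : Config (N + 1) => F (Fin.tail W))
      ((fderiv ℝ F (Fin.tail Z)).comp
        ((ContinuousLinearMap.snd ℝ Space (Config N)).comp
          ((Fin.consEquivL ℝ (fun _ : Fin (N + 1) => Space)).symm :
            Config (N + 1) →L[ℝ] Space × Config N))) Z :=
  hF.hasFDerivAt.comp Z ((ContinuousLinearMap.snd ℝ Space (Config N)).comp
    ((Fin.consEquivL ℝ (fun _ : Fin (N + 1) => Space)).symm :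
      Config (N + 1) →L[ℝ] Space × Config N)).hasFDerivAt

/-- `X ↦ F(tail X)` is `Cⁿ` for `Cⁿ` `F`. [folklore] -/
theorem tilt_contDiff_comp_tail {F : Config N → ℝ} {n : WithTop ℕ∞} (hF : ContDiff ℝ n F) :
    ContDiff ℝ n fun W : Config (N + 1) => F (Fin.tail W) :=
  hF.comp ((ContinuousLinearMap.snd ℝ Space (Config N)).comp
    ((Fin.consEquivL ℝ (fun _ : Fin (N + 1) => Space)).symm :
      Config (N + 1) →L[ℝ] Space × Config N)).contDiff

/-- `∂_{0,k}(F ∘ tail) = 0`. [folklore] -/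
theorem tilt_pderiv_comp_tail_zero {F : Config N → ℝ} (hF : Differentiable ℝ F) (Z : Config (N + 1))
    (k : Fin 3) : pderiv 0 k (fun W : Config (N + 1) => F (Fin.tail W)) Z = 0 := by
  unfold pderiv
  rw [(tilt_hasFDerivAt_comp_tail (hF _)).fderiv, ContinuousLinearMap.comp_apply]
  show fderiv ℝ F (Fin.tail Z)
    (Fin.tail (Pi.single (0 : Fin (N + 1)) (EuclideanSpace.single k (1 : ℝ)) : Config (N + 1))) = 0
  rw [tilt_tail_single_zero, map_zero]

/-- `∂_{j+1,k}(F ∘ tail)(Z) = (∂_{j,k}F)(tail Z)`. [folklore] -/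
theorem tilt_pderiv_comp_tail_succ {F : Config N → ℝ} (hF : Differentiable ℝ F) (Z : Config (N + 1))
    (j : Fin N) (k : Fin 3) :
    pderiv j.succ k (fun W : Config (N + 1) => F (Fin.tail W)) Z = pderiv j k F (Fin.tail Z) := by
  unfold pderiv
  rw [(tilt_hasFDerivAt_comp_tail (hF _)).fderiv, ContinuousLinearMap.comp_apply]
  show fderiv ℝ F (Fin.tail Z)
    (Fin.tail (Pi.single j.succ (EuclideanSpace.single k (1 : ℝ)) : Config (N + 1))) = _
  rw [tilt_tail_single_succ]

/-- **Chain rule along the bath directions**: `∂_{j,k}(G(x, ·))(Y) = (∂_{j+1,k} G)(x, Y)`. [folklore] -/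
theorem tilt_pderiv_vecCons_slice {G : Config (N + 1) → ℝ} (hG : Differentiable ℝ G) (x : Space)
    (Y : Config N) (j : Fin N) (k : Fin 3) :
    pderiv j k (fun W : Config N => G (Matrix.vecCons x W)) Y =
      pderiv j.succ k G (Matrix.vecCons x Y) := by
  have h : HasFDerivAt (fun W : Config N => G (Matrix.vecCons x W))
      ((fderiv ℝ G (Matrix.vecCons x Y)).comp
        (((Fin.consEquivL ℝ (fun _ : Fin (N + 1) => Space)) :
            Space × Config N →L[ℝ] Config (N + 1)).comp
          (ContinuousLinearMap.inr ℝ Space (Config N)))) Y :=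
    (hG _).hasFDerivAt.comp Y (hasFDerivAt_vecCons_right x Y)
  unfold pderiv
  rw [h.fderiv, ContinuousLinearMap.comp_apply]
  show fderiv ℝ G (Matrix.vecCons x Y)
    (Matrix.vecCons (0 : Space) (Pi.single j (EuclideanSpace.single k (1 : ℝ)) : Config N)) = _
  rw [vecCons_zero_single]

/-- **`Γ` of a tail function against a slice**: for `a = F ∘ tail`,
`Γ(a, G)(x, Y) = Γ(F, G(x, ·))(Y)` (the `∂_0` components of `a` vanish). [folklore] -/
theorem tilt_gradDot_tail_vecCons {F : Config N → ℝ} {G : Config (N + 1) → ℝ}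
    (hF : Differentiable ℝ F) (hG : Differentiable ℝ G) (x : Space) (Y : Config N) :
    gradDot (fun W : Config (N + 1) => F (Fin.tail W)) G (Matrix.vecCons x Y) =
      gradDot F (fun W : Config N => G (Matrix.vecCons x W)) Y := by
  rw [gradDot, Fin.sum_univ_succ]
  simp only [tilt_pderiv_comp_tail_zero hF, zero_mul, Finset.sum_const_zero, zero_add,
    tilt_pderiv_comp_tail_succ hF, tilt_pderiv_vecCons_slice hG, gradDot, mixedLaw_tail_vecCons]

end Slices

/-! ### The weak Euler–Lagrange equation of a real ground state, tested on ALL periodic `C¹` functions -/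

section EulerLagrange

variable {M : ℕ} {L : ℝ} {w : ℝ → ℝ≥0∞} {Θ : PeriodicTrialState M L}

/-- The weak E–L equation of a real nonnegative finite-energy periodic ground state `Θ`
(`E_w(Θ) = E₀(M, L)`), tested on Bose-SYMMETRIC lattice-periodic `C¹` functions `ζ`:
`∫∇|Θ|·∇(ζ|Θ|) + ∫ V ζ|Θ|² = E₀ ∫ ζ|Θ|²`, `V = ∑_{i<j} w^per(xᵢ - xⱼ)`
(`StaticResponseToHMinusOne.eulerLagrange` with `W = periodicInteraction w L`).
[cite: ReedSimonIV1978, §XIII.1 (Rayleigh–Ritz)] -/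
theorem tilt_el_symm (hw : Measurable w) (hreal : ∀ X, Θ.ψ X = (‖Θ.ψ X‖ : ℂ))
    (hE : periodicEnergy w Θ = periodicGroundStateEnergy w M L) (hfin : periodicEnergy w Θ ≠ ⊤)
    {ζ : Config M → ℝ} (hζ : ContDiff ℝ 1 ζ) (hζper : IsLatticePeriodic L ζ)
    (hζsymm : ∀ (σ : Equiv.Perm (Fin M)) (X : Config M), ζ (X ∘ σ) = ζ X) :
    (∫ X in cellN M L, gradDot (fun Y => ‖Θ.ψ Y‖) (fun Y => ζ Y * ‖Θ.ψ Y‖) X) +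
      (∫ X in cellN M L, (periodicInteraction w L X).toReal * ζ X * ‖Θ.ψ X‖ ^ 2) =
    (periodicEnergy w Θ).toReal * ∫ X in cellN M L, ζ X * ‖Θ.ψ X‖ ^ 2 :=
  eulerLagrange (v := w) (W := periodicInteraction w L) (measurable_periodicInteraction_of hw L)
    (fun _ => rfl) hreal hfin (fun Ψ => hE ▸ periodicGroundStateEnergy_le w Ψ) hζ hζper hζsymm

/-- Relabelling invariance of the kinetic term of the E–L functional:
`∫ ∇F·∇(ζ(·∘σ)F) = ∫ ∇F·∇(ζF)` for a Bose-symmetric `C¹` weight `F`. [folklore] -/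
theorem tilt_el_kinetic_comp_perm {F : Config M → ℝ} (hF : ContDiff ℝ 1 F)
    (hFsymm : ∀ (σ : Equiv.Perm (Fin M)) (Y : Config M), F (Y ∘ σ) = F Y) {ζ : Config M → ℝ}
    (hζ : ContDiff ℝ 1 ζ) (σ : Equiv.Perm (Fin M)) :
    ∫ X in cellN M L, gradDot F (fun Y => ζ (Y ∘ σ) * F Y) X =
      ∫ X in cellN M L, gradDot F (fun Y => ζ Y * F Y) X := by
  have hFd : Differentiable ℝ F := hF.differentiable one_ne_zero
  have hβd : Differentiable ℝ fun Y => ζ Y * F Y := (hζ.differentiable one_ne_zero).mul hFd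
  have hpt : ∀ X, gradDot F (fun Y => ζ (Y ∘ σ) * F Y) X =
      gradDot F (fun Y => ζ Y * F Y) (X ∘ σ) := by
    intro X
    have key := tilt_gradDot_comp_perm₂ hFd hβd σ X
    rw [show (fun Y => F (Y ∘ σ)) = F from funext (hFsymm σ)] at key
    simp only [hFsymm] at key
    exact key
  simp_rw [hpt]
  exact setIntegral_cellN_comp_perm L σ (gradDot F fun Y => ζ Y * F Y)

/-- The symmetrised test function `∑_σ ζ(·∘σ)` is lattice periodic. [folklore] -/
theorem tilt_isLatticePeriodic_symmetrise {ζ : Config M → ℝ} (hζper : IsLatticePeriodic L ζ) :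
    IsLatticePeriodic L fun X => ∑ σ : Equiv.Perm (Fin M), ζ (X ∘ σ) := by
  -- adapted from `isPeriodicTest_symmetrise` (ResponseDictionarySymm)
  intro X i k
  refine Finset.sum_congr rfl fun σ _ => ?_
  have h : (X + Pi.single i (EuclideanSpace.single k L)) ∘ σ =
      X ∘ σ + Pi.single (σ.symm i) (EuclideanSpace.single k L) := by
    rw [← single_comp_perm σ i]; rfl
  rw [h, hζper]

/-- The symmetrised test function `∑_σ ζ(·∘σ)` is Bose symmetric. [folklore] -/
theorem tilt_symmetrise_comp_perm (ζ : Config M → ℝ) (τ : Equiv.Perm (Fin M)) (X : Config M) :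
    (fun X => ∑ σ : Equiv.Perm (Fin M), ζ (X ∘ σ)) (X ∘ τ) =
      (fun X => ∑ σ : Equiv.Perm (Fin M), ζ (X ∘ σ)) X :=
  Equiv.sum_comp (Equiv.mulLeft τ) (fun σ : Equiv.Perm (Fin M) => ζ (X ∘ ⇑σ))

/-- **Weak Euler–Lagrange equation for ALL periodic `C¹` test functions.** For a measurable
profile `w` and a real nonnegative finite-energy periodic ground state `Θ` of `M` bosons
(`E_w(Θ) = E₀(M, L)`), every lattice-periodic `C¹` function `ζ` (NOT necessarily Bose symmetric)
satisfies `∫∇|Θ|·∇(ζ|Θ|) + ∫ V ζ|Θ|² = E₀ ∫ ζ|Θ|²`: the E–L functional is linear in `ζ` and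
invariant under relabelling `ζ ↦ ζ(·∘σ)` (Bose symmetry of `Θ` and of `V`, relabelling invariance
of the cell), so its value at `ζ` is `(M!)⁻¹` times its value at the Bose symmetrisation
`∑_σ ζ(·∘σ)`, where the symmetric equation applies. [cite: ReedSimonIV1978, §XIII.1 (Rayleigh–Ritz)] -/
theorem tilt_el_all {M : ℕ} {L : ℝ} {w : ℝ → ℝ≥0∞} {Θ : PeriodicTrialState M L} (hw : Measurable w)
    (hreal : ∀ X, Θ.ψ X = (‖Θ.ψ X‖ : ℂ)) (hE : periodicEnergy w Θ = periodicGroundStateEnergy w M L)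
    (hfin : periodicEnergy w Θ ≠ ⊤) {ζ : Config M → ℝ} (hζ : ContDiff ℝ 1 ζ)
    (hζper : IsLatticePeriodic L ζ) :
    (∫ X in cellN M L, gradDot (fun Y => ‖Θ.ψ Y‖) (fun Y => ζ Y * ‖Θ.ψ Y‖) X) +
      (∫ X in cellN M L, (periodicInteraction w L X).toReal * ζ X * ‖Θ.ψ X‖ ^ 2) =
    (periodicEnergy w Θ).toReal * ∫ X in cellN M L, ζ X * ‖Θ.ψ X‖ ^ 2 := by
  -- the symmetric equation for the symmetrisation `Z = ∑_σ ζ(·∘σ)`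
  have hζσ : ∀ σ : Equiv.Perm (Fin M), ContDiff ℝ 1 fun Y : Config M => ζ (Y ∘ σ) :=
    fun σ => contDiff_comp_perm_real hζ σ
  have hZC : ContDiff ℝ 1 fun X => ∑ σ : Equiv.Perm (Fin M), ζ (X ∘ σ) :=
    ContDiff.sum fun σ _ => hζσ σ
  have hEL := tilt_el_symm hw hreal hE hfin hZC (tilt_isLatticePeriodic_symmetrise hζper)
    (tilt_symmetrise_comp_perm ζ)
  have hUint0 := integrableOn_toReal_interaction_mul_norm_sq (Φ := Θ) hw hfin
  -- notation: `F = |Θ|`, `U = V.toReal`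
  obtain ⟨F, hFdef⟩ : ∃ F : Config M → ℝ, F = fun Y => ‖Θ.ψ Y‖ := ⟨_, rfl⟩
  obtain ⟨U, hUdef⟩ : ∃ U : Config M → ℝ, U = fun X => (periodicInteraction w L X).toReal :=
    ⟨_, rfl⟩
  have hF' : ∀ Y, ‖Θ.ψ Y‖ = F Y := fun Y => by rw [hFdef]
  have hU' : ∀ X, (periodicInteraction w L X).toReal = U X := fun X => by rw [hUdef]
  have hF : ContDiff ℝ 1 F := by rw [hFdef]; exact contDiff_norm_of_real Θ hreal
  have hFd : Differentiable ℝ F := hF.differentiable one_ne_zero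
  have hFsymm : ∀ (σ : Equiv.Perm (Fin M)) (Y : Config M), F (Y ∘ σ) = F Y := fun σ Y => by
    simp only [hFdef, Θ.symm σ Y]
  have hUsymm : ∀ (σ : Equiv.Perm (Fin M)) (Y : Config M), U (Y ∘ σ) = U Y := fun σ Y => by
    simp only [hUdef, periodicInteraction_comp_perm]
  simp only [hF', hU'] at hEL hUint0 ⊢
  -- integrability of the potential terms
  have hUint : ∀ σ : Equiv.Perm (Fin M),
      IntegrableOn (fun X => U X * ζ (X ∘ σ) * F X ^ 2) (cellN M L) := by
    intro σ
    obtain ⟨C, -, hC⟩ := exists_bound_on_cellN (hζσ σ).continuous L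
    have h := Integrable.bdd_mul (c := C) hUint0 (hζσ σ).continuous.aestronglyMeasurable
      (by
        rw [ae_restrict_iff' (measurableSet_cellN M L)]
        exact ae_of_all _ fun X hX => by rw [Real.norm_eq_abs]; exact hC X hX)
    exact IntegrableOn.congr_fun h (fun X _ => by ring) (measurableSet_cellN M L)
  -- expand the three terms of the symmetric equation as sums over `σ`
  have e1 : ∫ X in cellN M L, gradDot F
        (fun Y => (∑ σ : Equiv.Perm (Fin M), ζ (Y ∘ σ)) * F Y) X =
      (Fintype.card (Equiv.Perm (Fin M)) : ℝ) *
        ∫ X in cellN M L, gradDot F (fun Y => ζ Y * F Y) X := by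
    have hpt : ∀ X, gradDot F (fun Y => (∑ σ : Equiv.Perm (Fin M), ζ (Y ∘ σ)) * F Y) X =
        ∑ σ : Equiv.Perm (Fin M), gradDot F (fun Y => ζ (Y ∘ σ) * F Y) X := by
      intro X
      have h : (fun Y => (∑ σ : Equiv.Perm (Fin M), ζ (Y ∘ σ)) * F Y) =
          fun Y => ∑ σ : Equiv.Perm (Fin M), ζ (Y ∘ σ) * F Y := by
        funext Y; simp only [Finset.sum_mul]
      rw [h]
      exact tilt_gradDot_finset_sum_right _ F fun σ _ =>
        (((hζσ σ).differentiable one_ne_zero) X).mul (hFd X)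
    have hint : ∀ σ ∈ (Finset.univ : Finset (Equiv.Perm (Fin M))),
        Integrable (fun X => gradDot F (fun Y => ζ (Y ∘ σ) * F Y) X)
          (volume.restrict (cellN M L)) :=
      fun σ _ => integrableOn_cellN (continuous_gradDot hF ((hζσ σ).mul hF)) L
    simp_rw [hpt]
    rw [integral_finsetSum _ hint]
    simp only [tilt_el_kinetic_comp_perm hF hFsymm hζ, Finset.sum_const, Finset.card_univ,
      nsmul_eq_mul]
  have e2 : ∫ X in cellN M L, U X * (∑ σ : Equiv.Perm (Fin M), ζ (X ∘ σ)) * F X ^ 2 =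
      (Fintype.card (Equiv.Perm (Fin M)) : ℝ) * ∫ X in cellN M L, U X * ζ X * F X ^ 2 := by
    have hpt : ∀ X, U X * (∑ σ : Equiv.Perm (Fin M), ζ (X ∘ σ)) * F X ^ 2 =
        ∑ σ : Equiv.Perm (Fin M), U X * ζ (X ∘ σ) * F X ^ 2 := by
      intro X; simp only [Finset.mul_sum, Finset.sum_mul]
    have hterm : ∀ σ : Equiv.Perm (Fin M),
        ∫ X in cellN M L, U X * ζ (X ∘ σ) * F X ^ 2 = ∫ X in cellN M L, U X * ζ X * F X ^ 2 := by
      intro σ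
      have h := setIntegral_cellN_comp_perm L σ (fun X => U X * ζ X * F X ^ 2)
      simp only [hUsymm, hFsymm] at h
      exact h
    have hint : ∀ σ ∈ (Finset.univ : Finset (Equiv.Perm (Fin M))),
        Integrable (fun X => U X * ζ (X ∘ σ) * F X ^ 2) (volume.restrict (cellN M L)) :=
      fun σ _ => hUint σ
    simp_rw [hpt]
    rw [integral_finsetSum _ hint]
    simp only [hterm, Finset.sum_const, Finset.card_univ, nsmul_eq_mul]
  have e3 : ∫ X in cellN M L, (∑ σ : Equiv.Perm (Fin M), ζ (X ∘ σ)) * F X ^ 2 =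
      (Fintype.card (Equiv.Perm (Fin M)) : ℝ) * ∫ X in cellN M L, ζ X * F X ^ 2 := by
    have hpt : ∀ X, (∑ σ : Equiv.Perm (Fin M), ζ (X ∘ σ)) * F X ^ 2 =
        ∑ σ : Equiv.Perm (Fin M), ζ (X ∘ σ) * F X ^ 2 := by
      intro X; simp only [Finset.sum_mul]
    have hterm : ∀ σ : Equiv.Perm (Fin M),
        ∫ X in cellN M L, ζ (X ∘ σ) * F X ^ 2 = ∫ X in cellN M L, ζ X * F X ^ 2 := by
      intro σ
      have h := setIntegral_cellN_comp_perm L σ (fun X => ζ X * F X ^ 2)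
      simp only [hFsymm] at h
      exact h
    have hint : ∀ σ ∈ (Finset.univ : Finset (Equiv.Perm (Fin M))),
        Integrable (fun X => ζ (X ∘ σ) * F X ^ 2) (volume.restrict (cellN M L)) :=
      fun σ _ => integrableOn_cellN ((hζσ σ).continuous.mul (hF.continuous.pow 2)) L
    simp_rw [hpt]
    rw [integral_finsetSum _ hint]
    simp only [hterm, Finset.sum_const, Finset.card_univ, nsmul_eq_mul]
  rw [e1, e2, e3] at hEL
  have hcard : (Fintype.card (Equiv.Perm (Fin M)) : ℝ) ≠ 0 := by exact_mod_cast Fintype.card_ne_zero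
  apply mul_left_cancel₀ hcard
  linear_combination hEL

end EulerLagrange

end Summit.AtomisticToContinuum.BoseEinsteinCondensation.Theorems.CorrectorClosure.GeometricMeanCorrector

end
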